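import Summits.Ventures.CertifiedManyBodySolver.Downfold.EmeryFermiFillingTl2201Subs
import Summits.Ventures.CertifiedManyBodySolver.Downfold.EmeryFermiFillingLa214
import Summits.Ventures.CertifiedManyBodySolver.Downfold.EmeryBoxesKSlicesB
import HarnessLib

/-!
# Tl₂Ba₂CuO₆ (box #34 Tl-2201, (K) source rows; one-body rows are a POINT): the typed 3BE one-body box `emeryBoxTl2201K26Src` ⇒ a CERTIFIED window for the object-E Fermi-surface `t′/t` of the σ three-band
# model at the box's own hole count — and a certified MODEL-FORM CEILING against the E row of record

Venture CertifiedManyBodySolver, cell `pub/hubbard-downfold` (stage S1, HUMAN RULINGS D-0096/D-0098), seat hubbard-downfold-mod-4 (technique B = band level);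
namespace `Summit.Ventures.CertifiedManyBodySolver.Downfold.Emery`. Everything PROVED; numerics decided by the kernel (`EmeryFermiFillingTl2201Subs`).
Same device as `EmeryFermiFillingLa214` / `EmeryFermiFillingHg1201` / `EmeryFermiFillingLSCO`.

THE STATEMENT (`emeryBoxTl2201K26Src_fsRatio_window`). For every parameter vector of `emeryBoxTl2201K26Src` (`EmeryBoxesKSlicesB`: the Tl-2201 companion's ONE-BODY rows (a single (K) set) × n_H ∈ [1.25, 1.30]: Δ_pd [1.79, 1.79] × t_pd [1.27, 1.27] × t_pp [0.63, 0.63] × t_pp′ [0.15, 0.15]; n_H ∈ [1.25, 1.3])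
and every Fermi energy ε with `abFilling(ε) = (2 − n_H)/2` (the σ-model antibonding band holds the box's own electrons):
**`t′/t = fsRatio(ε) ∈ [-0.2874, -0.2852]`** and **ε ∈ [1.5, 1.68]** (box units, eV above ε_d).

READING — MODEL-FORM CEILING (certified): box #34's object-E row `t′/t (E) ∈ [−0.425, −0.324]` vs the σ-model window [-0.2874, -0.2852] on this one-body POINT × filling row:\nDISJOINT (`emeryBoxTl2201K26Src_fsRatio_not_objectE`). Tl-2201 is the r ≈ 0.33 axial-channel compound of [PavariniEtAl2001]: the certified gap between the σ Fermi-surface shape\nand the one-band FS of record is the axial (Cu-4s / apical / Tl-O) contribution, here bounded BELOW by |Δ(t′/t)| ≥ 0.324 − |-0.2852| at every filling of the row.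

WHAT THIS IS NOT: not a statement that the material's parameters ARE in the box (SCREENING-GRADE provenance); the theorem certifies the REDUCTION STEP
of the σ d–p_x–p_y(+t_pp, t_pp′) model only; not the interaction (`U`) reduction; no phase sentence. Sources: [HybertsenSchluterChristensen1989, Eq. (1)];
[AndersenEtAl1995, §6]; [PavariniEtAl2001, Eq. (1)].
-/

noncomputable section

namespace Summit.Ventures.CertifiedManyBodySolver.Downfold.Emery

open Real Set
open Summit.Ventures.CertifiedManyBodySolver.Downfold

/-- Per-spin antibonding filling from the box's hole count: `n_H ∈ [5/4, 13/10] ⇒ (2 − n_H)/2 ∈ [7/20, 3/8]`. [folklore] -/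
theorem abFilling_rowTl2201_of_nHoles {nH f : ℝ} (h1 : (5 / 4 : ℝ) ≤ nH) (h2 : nH ≤ (13 / 10 : ℝ)) (hf : f = (2 - nH) / 2) :
    f ∈ Set.Icc (7 / 20 : ℝ) (3 / 8 : ℝ) := by
  rw [hf]; constructor <;> linarith

/-- The five rows of `emeryBoxTl2201K26Src` this file reads. [folklore] -/
theorem emeryBoxTl2201K26Src_mem_rows {p : EmeryCoord → ℝ} (hp : emeryBoxTl2201K26Src.Mem p) :
    p .DeltaPd ∈ Set.Icc (179 / 100 : ℝ) (179 / 100 : ℝ) ∧ p .tpd ∈ Set.Icc (127 / 100 : ℝ) (127 / 100 : ℝ) ∧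
      p .tpp ∈ Set.Icc (63 / 100 : ℝ) (63 / 100 : ℝ) ∧ p .tppP ∈ Set.Icc (3 / 20 : ℝ) (3 / 20 : ℝ) ∧
      p .nHoles ∈ Set.Icc (5 / 4 : ℝ) (13 / 10 : ℝ) := by
  have hΔ := (Entry.mem_ofEnds_iff _ _ _ _ _).1 (hp .DeltaPd tl2201K26Emery_DeltaKS rfl)
  have ha := (Entry.mem_ofEnds_iff _ _ _ _ _).1 (hp .tpd tl2201K26Emery_tpd rfl)
  have hb := (Entry.mem_ofEnds_iff _ _ _ _ _).1 (hp .tpp tl2201K26Emery_tpp rfl)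
  have hc := (Entry.mem_ofEnds_iff _ _ _ _ _).1 (hp .tppP tl2201K26Emery_tppP rfl)
  have hn := (Entry.mem_ofEnds_iff _ _ _ _ _).1 (hp .nHoles tl2201K26Emery_nH rfl)
  push_cast at hΔ ha hb hc hn
  exact ⟨⟨hΔ.1, hΔ.2⟩, ⟨ha.1, ha.2⟩, ⟨hb.1, hb.2⟩, ⟨hc.1, hc.2⟩, ⟨hn.1, hn.2⟩⟩

/-- **THE WORD ON THE TYPED BOX `emeryBoxTl2201K26Src`**: at every parameter vector and every Fermi energy at which the σ-model antibonding band holds the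
box's own electron count, `ε ∈ [1.5, 1.68]` and the exact σ-model Fermi-surface `t′/t ∈ [-0.2874, -0.2852]`.
[cite: HybertsenSchluterChristensen1989, Eq. (1) (three-band d–p model)] -/
theorem emeryBoxTl2201K26Src_fsRatio_window :
    HoldsOn (fun p : EmeryCoord → ℝ => ∀ ε : ℝ,
      abFilling (p .DeltaPd) (p .tpd) (p .tpp) (p .tppP) ε = (2 - p .nHoles) / 2 →
      ε ∈ Set.Icc (3 / 2 : ℝ) (42 / 25 : ℝ) ∧
      fsRatio (p .DeltaPd) (p .tpd) (p .tpp) (p .tppP) ε ∈ Set.Icc (-(1437 / 5000 : ℝ)) (-(713 / 2500 : ℝ))) emeryBoxTl2201K26Src := by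
  intro p hp ε hf
  obtain ⟨hΔ, ha, hb, hc, hn⟩ := emeryBoxTl2201K26Src_mem_rows hp
  exact tl2201Sub_0_0 hΔ ha hb hc (abFilling_rowTl2201_of_nHoles hn.1 hn.2 hf)

/-- **MODEL-FORM CEILING, CERTIFIED**: on the whole box the σ-model Fermi-surface `t′/t` window [-0.2874, -0.2852] is DISJOINT from the object-E
row of record `[-0.425, -0.324]` (router/BOXES/Tl2Ba2CuO6.md l.31 «tp/t (E) [−0.425, −0.324]») — the d–p_x–p_y(+t_pp, t_pp′) model cannot produce this material's one-band Fermi-surface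
shape anywhere in its 3BE box. [folklore] -/
theorem emeryBoxTl2201K26Src_fsRatio_not_objectE :
    HoldsOn (fun p : EmeryCoord → ℝ => ∀ ε : ℝ,
      abFilling (p .DeltaPd) (p .tpd) (p .tpp) (p .tppP) ε = (2 - p .nHoles) / 2 →
      fsRatio (p .DeltaPd) (p .tpd) (p .tpp) (p .tppP) ε ∉ Set.Icc (-(17 / 40 : ℝ)) (-(81 / 250 : ℝ))) emeryBoxTl2201K26Src := by
  intro p hp ε hf hmem
  have h := (emeryBoxTl2201K26Src_fsRatio_window p hp ε hf).2
  have : (-(81 / 250 : ℝ)) < (-(1437 / 5000 : ℝ)) := by norm_num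
  linarith [h.1, hmem.2]

end Summit.Ventures.CertifiedManyBodySolver.Downfold.Emery
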